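import Summits.ResolutionOfSingularities.ResolutionOfSingularities.Theorems.HilbertSamuelEliminationCampaignW42RidgeDimMonotone
import Summits.ResolutionOfSingularities.ResolutionOfSingularities.Theorems.Rescue.RR107DirectrixRidge
import HarnessLib

/-!
# [OURS · L · F-54 DISCHARGE] Dietel (8.2.7) (ii) AS TYPED — `Dietel2015_nearPoint_ridge` holds outright: at a near point
# of a permissible blow-up of a LOCALLY NOETHERIAN scheme (no excellence, no catenarity), `dim F_{x'}(X') + tr.deg ≤ dim F_x(X)`
# and `dim 𝒪_{D,x} < dim F_x(X)` (cell res-hironaka, HIRONAKA-L librarian res-D-lib-1; FACT-LIST F-54; `--supports` O1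
# stmt-ResolutionOfSingularities-17845)

HONEST FRAMING. OURS proof file (res-D-lib-1 gen 7), FACT-FREE. It DISCHARGES the named Literature fact F-54
`Literature.AlgebraicGeometry.Resolution.Dietel2015_nearPoint_ridge` (B. Dietel, Dissertation Regensburg 2015, Satz (8.2.7) (ii),
typed statement-only in `Literature/AlgebraicGeometry/Resolution/NearPointRidgeDietel.lean`) by RECOMBINING tree theorems of
campaign s42 (prover res-L1-s42-pv-1, gens 3–5: `…CampaignW42PermissibleNearEqualities`, `…PermissibleConeDictionary`,
`…FibreConePresentation`, `…ConeRidgeDimPrime`, `…HypersurfaceSectionRidge`, `…RidgeDimMonotone`) and of res-L1-type-o1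
(`…CampaignW42NearAlignment`). The file lives summit-side because those theorems live in `Summits/…/Theorems` (precedent: F-50,
`MizutaniConjectureHolds`). NOTHING here is a statement of H. Hironaka's manuscript [Hironaka2017]; nothing about resolution of
singularities in positive characteristic is asserted. Dietel's dissertation is a THESIS-flagged source; what is proved here is the
tree's typed rendering of its Satz (8.2.7) (ii), by the tree's own route (Giraud's ridge, CJS Thm. 3.10 chain), not by the thesis'
Hilbert-series argument. AI-produced; AI review is weaker than expert review.

## Why F-54 is now a corollary, and where universal catenarity disappears

s42-pv-1's local theorem `CampaignW42.exists_localRidgeDim_add_le_of_isNearRing` (B8, `…RidgeDimMonotone`) proves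
`dim F(𝒪') + d ≤ dim F(C_{X,D,x}) + s` at a point `𝒪' = 𝒪[𝔭/c_j]_𝔴` NEAR to `𝒪` in the CJS sense
(`IsNearRing 𝒪 𝒪' N`: `H⁽ᴺ⁻ψ(𝒪')⁾(𝒪') = H⁽ᴺ⁻ψ(𝒪)⁾(𝒪)`), for `𝒪` UNIVERSALLY CATENARY: catenarity is used exactly once, in
`near_chain_equalities`, to produce the chain of primes from `𝔴` with `ψ(𝒪) ≤ ψ(𝒪') + ℓ` that converts the `ψ`-indexed nearness
into the circle of inequalities `H⁽ⁱ⁾(𝒪) ≤ H⁽ⁱ⁺ˡ⁾(𝒪') ≤ H⁽ⁱ⁺ˡ⁺ˢ⁺¹⁾(R_𝔮) ≤ … ≤ H⁽ⁱ⁺ˢ⁾(R) ≤ H⁽ⁱ⁾(𝒪)`. F-54 is typed with Dietel's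
OWN hypothesis «(8.2.7.A) is an equality», `H⁽ᵈ⁺¹⁾(𝒪') = H⁽¹⁾(𝒪)` with `d = tr.deg(κ(x')/κ(x))`, which enters the same circle
one link later and needs no `ψ`: `d = dim C/𝔴` (o1's `exists_ringKrullDim_quotient_eq_and_trdeg_eq`, Matsumura Thm. 5.6 on the
fibre, no catenarity), a chain of primes of length exactly `d` issues from `𝔴` (`Order.exists_series_of_coheight_eq_coe`), and the
tree's sharp Bennett–Singh link `hilbertSamuelFun_le_localizedPolynomial_quotient` / Bennett in `R = FibreConeLocal 𝔭` / the vertex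
inequality close the circle (`chain_equalities_of_hilbertSamuelFun_add_length_eq`, this file — the proof body of
`near_chain_equalities` with the first link replaced). From the equalities on, s42-pv-1's steps (A) cone theorem at the line `𝔮`
(B7 `localRidgeDim_add_le_ridgeDim_of_hilbertFunQuot_le_hilbertSamuelFun`), (B) Nagata's `𝒪'(X)` cut down to `R_𝔮`
(`localRidgeDim_le_localRidgeDim_add_of_hilbertSamuelFun_eq`), (C) Hironaka–Grothendieck `dim F_x(X) = dim F(C_{X,D,x}) + s`
(F-split `HerrmannIkedaOrbanz1988_cor_21_11_holds`, `exists_minimal_generators_data`) run VERBATIM (proof bodies re-run here and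
credited; statements used by name). The second conjunct of F-54, `dim 𝒪_{D,x} < dim F_x(X)`, is `s < dim F(C_{X,D,x}) + s`, i.e.
`1 ≤ dim F(C_{X,D,x})`, which is step (A) with `dim R/𝔮 ≥ 1` (the line of `x'` lies in the ridge of the fibre cone).

## Contents (namespace `…Theorems.CampaignW42`)

* `chain_equalities_of_hilbertSamuelFun_add_length_eq` — local rings, ANY noetherian local `𝒪`: a chain of primes of length
  `ℓ` from `𝔴` and `H⁽ⁱ⁺ˡ⁾(𝒪') = H⁽ⁱ⁾(𝒪)` force `dim R/𝔮 = ℓ + 1`, Bennett EQUALITY at `𝔮` and the vertex equality;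
* `localRidgeDim_add_length_le_of_hilbertSamuelFun_eq` — local rings: `dim F(𝒪') + ℓ ≤ dim F(C_{X,D,x}) + s` and
  `1 ≤ dim F(C_{X,D,x})` under `H⁽ˡ⁺¹⁾(𝒪') = H⁽¹⁾(𝒪)`;
* **`Literature.AlgebraicGeometry.Resolution.Dietel2015_nearPoint_ridge_holds : Dietel2015_nearPoint_ridge`** (declared with
  its absolute name next to the fact, so that `Dietel2015_nearPoint_ridge` / `…_holds` sit together for consumers) and the
  summit-side alias `CampaignW42.dietel2015_nearPoint_ridge_holds`;
* `Rescue.RR_107_of_mainTheoremC : Dietel2015_mainTheoremC → Rescue.RR_107` — the rescue-catalogue row RR-107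
  (`Rescue/RR107DirectrixRidge.lean`, `RR_107_of_facts`) is now TRUE MODULO F-58 ALONE.

VACUITY. Not vacuous: every point of the blow-up of a regular scheme in a regular centre satisfies the hypothesis with equality
(CJS Thm. 3.10); the conclusion is sharp at rational points of the exceptional divisor of a point blow-up of a cone.

## References (orientation only)

* B. Dietel, Dissertation Regensburg (2015), Satz (8.2.7) (ii) p. 105, (8.2.7.2) p. 106. [Dietel2015]
* V. Cossart, U. Jannsen, S. Saito, LNM 2270 (2020), Thm. 2.33, Thm. 3.10 and its proof (3.7)–(3.9), (3.14), Rem. 18.29 (1).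
  [CossartJannsenSaito2020]
* M. Herrmann, S. Ikeda, U. Orbanz, *Equimultiplicity and Blowing up* (1988), Cor. (21.11), Thm. (30.2), Thm. (31.1).
  [HerrmannIkedaOrbanz1988]
* J. Giraud, Ann. Sci. ÉNS (4) 8 (1975), Cor. 2.4. [Giraud1975]  · H. Matsumura, *Commutative Ring Theory*, Thm. 5.6. [Matsumura1987]
-/

noncomputable section

-- single-conjunct summit: the doubled namespace component `ResolutionOfSingularities` is mandated
set_option linter.dupNamespace false

open CategoryTheory AlgebraicGeometry TopologicalSpace IsLocalRing MvPolynomial Module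
open Literature.AlgebraicGeometry.Resolution Literature.AlgebraicGeometry.Resolution.HironakaScheme
open Literature.RingTheory.HilbertSamuel Literature.RingTheory.MvPolynomial
open Literature.AlgebraicGeometry.CossartJannsenSaito2020
open Summit.ResolutionOfSingularities.ResolutionOfSingularities.Theorems.SigmaMaxModificationsCorridor3.Directrix214Sharp

namespace Summit.ResolutionOfSingularities.ResolutionOfSingularities.Theorems

universe u

namespace CampaignW42

/-! ## Local rings: the Bennett–Hironaka–Singh circle closed by Dietel's equality (no catenarity) -/

section Chart

variable {O : Type u} [CommRing O] [IsLocalRing O] [IsNoetherianRing O] {n : ℕ} (c : Fin n → O) (j : Fin n)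

local notation3 "𝔭" => Ideal.span (Set.range c)
local notation3 "hcj" => Ideal.mem_span_range_self (f := c) (x := j)

variable (P : Ideal (chartRing c j)) [P.IsPrime]
variable (O' : Type u) [CommRing O'] [Algebra (chartRing c j) O'] [IsLocalization.AtPrime O' P]
  [IsLocalRing O'] [Algebra O O']

/-- **All links of the Bennett–Hironaka–Singh chain are equalities under Dietel's equality — ANY noetherian local `𝒪`.**
`𝔭 = (c_1, …, c_n)` permissible (`𝒪/𝔭` regular of dimension `s`, `𝒪` normally flat along `𝔭`), `C = 𝒪[𝔭/c_j]`, `P ⊆ C` a prime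
over `𝔫`, `𝒪' = C_P`, `t` a strict chain of primes of `C` issuing from `P`, of length `ℓ`. If `H⁽ⁱ⁺ˡ⁾(𝒪') = H⁽ⁱ⁾(𝒪)` for some `i`,
then `d := dim R/𝔮` (`R = FibreConeLocal 𝔭`, `𝔮 = coneLocalPrime`) equals `ℓ + 1`, **`H⁽ᵈ⁾(R_𝔮) = H⁽⁰⁾(R)`** (Bennett equality at
the line of the fibre cone) and **`H⁽ˢ⁾(R) = H⁽⁰⁾(𝒪)`** (vertex). This is `near_chain_equalities` (res-L1-s42-pv-1,
`…CampaignW42PermissibleNearEqualities`) with its first link — the only place universal catenarity was used — replaced by the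
hypothesis; the rest of the proof body is re-run verbatim. OURS; NOT a statement of the manuscript.
[cite: CossartJannsenSaito2020, Thm. 3.10 (proof, (3.14))] [cite: HerrmannIkedaOrbanz1988, Thm. (30.2), Thm. (31.1)] -/
theorem chain_equalities_of_hilbertSamuelFun_add_length_eq [(𝔭).IsPrime]
    [IsRegularLocalRing (O ⧸ 𝔭)] {s : ℕ} (hs : ringKrullDim (O ⧸ 𝔭) = s) (hNF : (𝔭).IsNormallyFlat)
    (hP : P.comap (chartBase c j) = maximalIdeal O)
    (hOO' : ∀ r : O, algebraMap O O' r = (algebraMap (chartRing c j) O' : chartRing c j →+* O') (chartBase c j r))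
    (t : LTSeries (PrimeSpectrum (chartRing c j))) (ht : t.head.asIdeal = P) {i : ℕ}
    (hnear : hilbertSamuelFun O' (i + t.length) = hilbertSamuelFun O i)
    {d : ℕ} (hd : haveI := isPrime_coneLocalPrime (c j) hcj P hP
      ringKrullDim (FibreConeLocal (𝔭) ⧸ coneLocalPrime (c j) hcj P) = d) :
    haveI := isPrime_coneLocalPrime (c j) hcj P hP
    d = t.length + 1 ∧
    hilbertSamuelFun (Localization.AtPrime (coneLocalPrime (c j) hcj P)) d =
      hilbertSamuelFun (FibreConeLocal (𝔭)) 0 ∧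
    hilbertSamuelFun (FibreConeLocal (𝔭)) s = hilbertSamuelFun O 0 := by
  haveI hq := isPrime_coneLocalPrime (c j) hcj P hP
  haveI := isLocalRing_localizedPolynomial_quotient (c j) hcj P O' hP hOO'
  haveI := isNoetherianRing_chart c j
  haveI : IsNoetherianRing O' := IsLocalization.isNoetherianRing P.primeCompl O' inferInstance
  obtain ⟨x, hx⟩ := exists_maximalIdeal_eq_sup_span_range (𝔭) hs
  set R := FibreConeLocal (𝔭)
  set q := coneLocalPrime (c j) hcj P
  set ℓ := t.length
  -- (0) Dietel's equality: `H[𝒪](i) = H[𝒪'](i + ℓ)`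
  have h0 : hilbertSamuelFun O i ≤ hilbertSamuelFun O' (i + ℓ) := hnear.symm.le
  -- (1) `H[𝒪'](i+ℓ) ≤ H[R_q](i+ℓ+s+1)`
  have h1 := hilbertSamuelFun_le_localizedPolynomial_quotient c j P O' hP hOO' x hx (i + ℓ)
  rw [hilbertSamuelFun_localizedPolynomial_quotient_eq (c j) hcj P O' hP hOO'] at h1
  -- (2) Bennett in `R` at `q`, `d ≥ ℓ + 1`
  have hℓd : ℓ + 1 ≤ d := by
    have h := length_succ_le_ringKrullDim_fibreConeLocal_quotient (c j) hcj P hP t ht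
    rw [hd] at h
    exact_mod_cast h
  have hG : IsGRing R := isGRing_fibreConeLocal (𝔭)
  have hB : ∀ s', hilbertSamuelFun (Localization.AtPrime q) (s' + d) ≤ hilbertSamuelFun R s' :=
    hilbertSamuelFun_add_le_of_ringKrullDim_quotient_eq_of_ringHom_field
      (fibreConeLocalResidueMap (𝔭)) (fun q' Q _ _ hqQ hadj _ =>
        module_finite_integralClosure_range_localization_quotient_of_isGRing hG Q _
          (ringKrullDim_localization_quotient_map_eq_one hqQ hadj)) d q hd
  have h2a : hilbertSamuelFun (Localization.AtPrime q) (i + ℓ + (s + 1)) ≤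
      hilbertSamuelFun (Localization.AtPrime q) ((i + ℓ + (s + 1) - d) + d) :=
    hilbertSamuelFun_mono (by omega)
  have h2b : hilbertSamuelFun (Localization.AtPrime q) ((i + ℓ + (s + 1) - d) + d) ≤
      hilbertSamuelFun R (i + ℓ + (s + 1) - d) := hB _
  have h2c : hilbertSamuelFun R (i + ℓ + (s + 1) - d) ≤ hilbertSamuelFun R (i + s) :=
    hilbertSamuelFun_mono (by omega)
  -- (3) the vertex
  have h3 := hilbertSamuelFun_fibreConeLocal_add_le (𝔭) hs hNF i
  -- closing the circle: every link is an equality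
  have e3 : hilbertSamuelFun R (i + s) = hilbertSamuelFun O i :=
    le_antisymm h3 (h0.trans (h1.trans (h2a.trans (h2b.trans h2c))))
  have e2c : hilbertSamuelFun R (i + ℓ + (s + 1) - d) = hilbertSamuelFun R (i + s) :=
    le_antisymm h2c (by rw [e3]; exact h0.trans (h1.trans (h2a.trans h2b)))
  have e2b : hilbertSamuelFun (Localization.AtPrime q) ((i + ℓ + (s + 1) - d) + d) =
      hilbertSamuelFun R (i + ℓ + (s + 1) - d) :=
    le_antisymm h2b (by rw [e2c, e3]; exact h0.trans (h1.trans h2a))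
  have e2a : hilbertSamuelFun (Localization.AtPrime q) (i + ℓ + (s + 1)) =
      hilbertSamuelFun (Localization.AtPrime q) ((i + ℓ + (s + 1) - d) + d) :=
    le_antisymm h2a (by rw [e2b, e2c, e3]; exact h0.trans h1)
  -- `d = ℓ + 1`
  have hidx1 := hilbertSamuelFun_index_injective e2c
  have hidx2 := hilbertSamuelFun_index_injective e2a
  have hdℓ : d = ℓ + 1 := by omega
  refine ⟨hdℓ, ?_, ?_⟩
  · -- Bennett equality: cancel the index `i + s`
    have h : hilbertSamuelFun (Localization.AtPrime q) ((i + s) + d) = hilbertSamuelFun R ((i + s) + 0) := by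
      rw [add_zero, ← e2c, ← e2b]
      congr 1
      omega
    exact hilbertSamuelFun_eq_of_add_eq h
  · -- vertex: cancel the index `i`
    have h : hilbertSamuelFun R (i + s) = hilbertSamuelFun O (i + 0) := by rw [add_zero]; exact e3
    exact hilbertSamuelFun_eq_of_add_eq h

variable [IsNoetherianRing O']

/-- **Dietel (8.2.7) (ii), ridge half, in the local rings — ANY noetherian local `𝒪`, every characteristic, any residue field.**
`𝔭 = (c_1, …, c_n)` permissible with `dim 𝒪/𝔭 = s` whose fibre-cone ideal `I(c) ⊆ k[Y]` has no linear forms (e.g. `c` minimal),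
`𝒪' = 𝒪[𝔭/c_j]_𝔴` (`𝔴` over `𝔫`), `t` a strict chain of primes of `𝒪[𝔭/c_j]` from `𝔴` of length `ℓ`, and Dietel's equality
`H⁽ˡ⁺¹⁾(𝒪') = H⁽¹⁾(𝒪)`. Then **`dim F(𝒪') + ℓ ≤ dim F(C_{X,D,x}) + s`** (`ridgeDim (fibreConeIdeal c) + s`) and
**`1 ≤ dim F(C_{X,D,x})`**. Steps (A) cone theorem at the line (B7), (B) Nagata's `𝒪'(X)` and its `s + 1` sections, (C) assembly
are the proof body of res-L1-s42-pv-1's `exists_localRidgeDim_add_le_of_isNearRing` (`…CampaignW42RidgeDimMonotone`), re-run on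
the catenary-free equalities of `chain_equalities_of_hilbertSamuelFun_add_length_eq`. OURS; NOT a statement of the manuscript.
[cite: Dietel2015, Satz (8.2.7) (ii) p. 105] [cite: CossartJannsenSaito2020, Thm. 3.10 (4), Rem. 18.29 (1)] -/
theorem localRidgeDim_add_length_le_of_hilbertSamuelFun_eq [(𝔭).IsPrime]
    [IsRegularLocalRing (O ⧸ 𝔭)] {s : ℕ} (hs : ringKrullDim (O ⧸ 𝔭) = s) (hNF : (𝔭).IsNormallyFlat)
    (hP : P.comap (chartBase c j) = maximalIdeal O)
    (hOO' : ∀ r : O, algebraMap O O' r = (algebraMap (chartRing c j) O' : chartRing c j →+* O') (chartBase c j r))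
    (hI1 : finrank (ResidueField O) (idealDegree (fibreConeIdeal c) 1) = 0)
    (t : LTSeries (PrimeSpectrum (chartRing c j))) (ht : t.head.asIdeal = P)
    (hnear : hilbertSamuelFun O' (t.length + 1) = hilbertSamuelFun O 1) :
    localRidgeDim O' + t.length ≤ ridgeDim (fibreConeIdeal c) + s ∧ 1 ≤ ridgeDim (fibreConeIdeal c) := by
  classical
  haveI h𝔮 := isPrime_coneLocalPrime (c j) hcj P hP
  haveI h𝔓 := isPrime_chartConePrime c j P hP
  haveI := isNoetherianRing_chart c j
  obtain ⟨d, hd⟩ := Literature.RingTheory.HilbertSamuel.exists_ringKrullDim_quotient_eq_nat (FibreConeLocal (𝔭))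
    (coneLocalPrime (c j) hcj P)
  have hnear' : hilbertSamuelFun O' (1 + t.length) = hilbertSamuelFun O 1 := by rw [add_comm]; exact hnear
  obtain ⟨hdℓ, hBen, hVert⟩ := chain_equalities_of_hilbertSamuelFun_add_length_eq c j P O' hs hNF hP hOO' t ht hnear' hd
  have h1d : 1 ≤ d := by omega
  have hOO : hilbertSamuelFun O' (d - 1) = hilbertSamuelFun O 0 := by
    have h : hilbertSamuelFun O' (1 + (d - 1)) = hilbertSamuelFun O (1 + 0) := by
      rw [add_zero, show 1 + (d - 1) = t.length + 1 by omega]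
      exact hnear
    exact hilbertSamuelFun_eq_of_add_eq h
  -- (A) the cone theorem at the line `𝔮` of the fibre cone
  have hI𝔓 := fibreConeIdeal_le_chartConePrime c j P
  haveI := isPrime_map_quotientMk_of_le hI𝔓
  have hdS : ringKrullDim (MvPolynomial (Fin n) (ResidueField O) ⧸ chartConePrime c j P) = d :=
    (ringKrullDim_quotient_chartConePrime_eq c j P hP).trans hd
  have hH : hilbertFunQuot (ResidueField O) n (fibreConeIdeal c) =
      hilbertSamuelFun (Localization.AtPrime (coneLocalPrime (c j) hcj P)) d := by
    rw [hBen, hilbertSamuelFun_zero, hilbertFun_fibreConeLocal_eq_hilbertFunQuot c]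
  have hA : localRidgeDim (Localization.AtPrime (coneLocalPrime (c j) hcj P)) + d ≤ ridgeDim (fibreConeIdeal c) := by
    letI := algebraOfFibreCone c (Localization.AtPrime (coneLocalPrime (c j) hcj P))
    haveI := isLocalization_atPrime_coneLocalPrime c j P hP
    exact localRidgeDim_add_le_ridgeDim_of_hilbertFunQuot_le_hilbertSamuelFun (isHomogeneousIdeal_fibreConeIdeal c) hI1
      hI𝔓 hdS rfl (Localization.AtPrime (coneLocalPrime (c j) hcj P)) hH.le
  -- (B) Nagata's `O'(X)` and its `s + 1` hypersurface sections down to `R_𝔮`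
  haveI hlocq := isLocalRing_localizedPolynomial_quotient (c j) hcj P O' hP hOO'
  obtain ⟨x, hx⟩ := exists_maximalIdeal_eq_sup_span_range (𝔭) hs
  have hchain : hilbertSamuelFun (Localization.AtPrime (coneLocalPrime (c j) hcj P)) ((d - 1) + (s + 1)) =
      hilbertSamuelFun O' ((d - 1) + 0) := by
    have h1 := hilbertSamuelFun_add_eq_of_eq hBen s
    rw [add_zero] at h1 ⊢
    rw [show d - 1 + (s + 1) = s + d by omega, h1, hVert, ← hOO]
  have hHq : hilbertSamuelFun (Localization.AtPrime (coneLocalPrime (c j) hcj P)) (s + 1) = hilbertFun O' := by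
    have h := hilbertSamuelFun_eq_of_add_eq hchain
    rw [hilbertSamuelFun_zero] at h
    exact h
  have hHN : hilbertSamuelFun (LocalizedPolynomial O' ⧸ (maximalIdeal O).map (algebraMap O (LocalizedPolynomial O')))
      (s + 1) = hilbertFun (LocalizedPolynomial O') := by
    rw [hilbertSamuelFun_localizedPolynomial_quotient_eq (c j) hcj P O' hP hOO' (s + 1), hHq, hilbertFun_localizedPolynomial]
  -- the `s + 1` generators `c_j, y_1, …, y_s` of `𝔫 O'(X)`
  let tg : Fin (s + 1) → LocalizedPolynomial O' :=
    Fin.cons (algebraMap O (LocalizedPolynomial O') (c j)) fun k => algebraMap O (LocalizedPolynomial O') (x k)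
  have hK : (maximalIdeal O).map (algebraMap O (LocalizedPolynomial O')) = Ideal.span (Set.range tg) := by
    refine le_antisymm ?_ ?_
    · rw [hx, Ideal.map_sup, map_span_range_localizedPolynomial_eq c j O' hOO', Ideal.map_span]
      refine sup_le ?_ ?_
      · rw [Ideal.span_singleton_le_iff_mem]
        exact Ideal.subset_span ⟨0, by simp only [tg, Fin.cons_zero]⟩
      · rw [Ideal.span_le]
        rintro _ ⟨_, ⟨k, rfl⟩, rfl⟩
        exact Ideal.subset_span ⟨k.succ, by simp only [tg, Fin.cons_succ]⟩
    · rw [Ideal.span_le]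
      rintro _ ⟨k, rfl⟩
      refine Fin.cases ?_ (fun k => ?_) k
      · simp only [tg, Fin.cons_zero]
        refine Ideal.mem_map_of_mem _ ?_
        rw [hx]
        exact Ideal.mem_sup_left hcj
      · simp only [tg, Fin.cons_succ]
        refine Ideal.mem_map_of_mem _ ?_
        rw [hx]
        exact Ideal.mem_sup_right (Ideal.subset_span ⟨k, rfl⟩)
  have hB : localRidgeDim (LocalizedPolynomial O') ≤
      localRidgeDim (LocalizedPolynomial O' ⧸ (maximalIdeal O).map (algebraMap O (LocalizedPolynomial O'))) + (s + 1) := by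
    refine localRidgeDim_le_localRidgeDim_add_of_hilbertSamuelFun_eq ?_ tg ?_ hHN
    · rw [Ideal.Quotient.algebraMap_eq]; exact Ideal.Quotient.mk_surjective
    · rw [Ideal.Quotient.algebraMap_eq, Ideal.mk_ker, hK]
  -- (C) assemble
  obtain ⟨e⟩ := nonempty_ringEquiv_coneLocal_localizedPolynomial_quotient (c j) hcj P O' hP hOO'
  have hRq : localRidgeDim (LocalizedPolynomial O' ⧸ (maximalIdeal O).map (algebraMap O (LocalizedPolynomial O'))) =
      localRidgeDim (Localization.AtPrime (coneLocalPrime (c j) hcj P)) := (localRidgeDim_eq_of_ringEquiv e).symm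
  have hRN : localRidgeDim (LocalizedPolynomial O') = localRidgeDim O' := localRidgeDim_localizedPolynomial O'
  rw [hRN, hRq] at hB
  constructor <;> omega

end Chart

/-! ## Schemes: F-54 as typed -/

/-- **F-54 DISCHARGED — Dietel 2015, Satz (8.2.7) (ii) AS TYPED (`Dietel2015_nearPoint_ridge`) holds**: for `X`, `X'` locally
noetherian, `π : X' → X` a blow-up in `D`, `x'` over a point of `supp D` at which `D` is permissible, `d = tr.deg(κ(x')/κ(π x'))`
and `H⁽ᵈ⁺¹⁾[𝒪_{X',x'}] = H⁽¹⁾[𝒪_{X,π x'}]`: **`dim F_{x'}(X') + d ≤ dim F_{π x'}(X)`** and **`dim 𝒪_{D,π x'} < dim F_{π x'}(X)`** —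
NO excellence or catenarity hypothesis, every characteristic, every residue field. Declared with its absolute name next to the
fact (same namespace as `Dietel2015_nearPoint_ridge`), from this summit-side file because the proof imports
`Summits/…/Theorems/HilbertSamuelEliminationCampaignW42*`. Proof: minimal generators `(g, y)` adapted to `D` and
`dim F_x(X) = dim F(C_{X,D,x}) + s` (F-split `HerrmannIkedaOrbanz1988_cor_21_11_holds`, `exists_minimal_generators_data`); the Rees
chart `𝒪_{X',x'} = 𝒪[𝔭/g_j]_𝔴` (`IsBlowup.exists_reesChart_stalk`); `dim 𝒪[𝔭/g_j]/𝔴 = d` (o1's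
`exists_ringKrullDim_quotient_eq_and_trdeg_eq`); a chain of primes of length `d` from `𝔴`; then
`localRidgeDim_add_length_le_of_hilbertSamuelFun_eq`. OURS proof of a THESIS-flagged published statement as typed; NOT a statement
of the manuscript [Hironaka2017]. [cite: Dietel2015, Satz (8.2.7) (ii) p. 105] [cite: CossartJannsenSaito2020, Thm. 3.10, Rem. 18.29 (1)]
[cite: Giraud1975, Cor. 2.4] -/
theorem _root_.Literature.AlgebraicGeometry.Resolution.Dietel2015_nearPoint_ridge_holds :
    Dietel2015_nearPoint_ridge.{u} := by
  intro X X' _ _ π D hπ x' _ hperm d htr hH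
  classical
  have hIperm : (stalkIdeal D (π.base x')).IsPermissible := hperm
  -- minimal generators `(g, y)` of `𝔫 = 𝔪_{X,x}` adapted to `D`, and `dim F_x(X) = dim F(C_{X,D,x}) + s`
  obtain ⟨n, s, g, y, hz, hgI, hn, hdimI, hE, hJz⟩ :=
    exists_minimal_generators_data HerrmannIkedaOrbanz1988_cor_21_11_holds hIperm
  let L := AlgebraicClosure (ResidueField (X.presheaf.stalk (π.base x')))
  have hR : Scheme.ridgeDim X (π.base x') = ridgeDim (normalConeIdeal g) + s := by
    change localRidgeDim (X.presheaf.stalk (π.base x')) = _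
    rw [localRidgeDim_eq_dirDimOver_of_perfectField (X.presheaf.stalk (π.base x')) L,
      dirDimOver_eq' (X.presheaf.stalk (π.base x')) L hE (Fin.append g y) hz, hJz, map_map_rename_eq,
      directrixDim_map_rename_castAdd]
    congr 1
    exact (radical_ridgeIdeal_coneIdeal_eq_and_ridgeDim_eq (normalConeIdeal g) (isHomogeneousIdeal_normalConeIdeal g) L).2.symm
  -- no linear forms in `I(g)` (the generators are minimal)
  have hI1 : finrank (ResidueField (X.presheaf.stalk (π.base x'))) (idealDegree (fibreConeIdeal g) 1) = 0 := by
    rw [fibreConeIdeal_eq_normalConeIdeal]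
    refine finrank_idealDegree_one_eq_zero_of_map_rename s (normalConeIdeal g) ?_
    rw [← hJz]
    exact finrank_idealDegree_tangentConeIdeal_one_eq_zero hE (Fin.append g y) hz
  -- the Rees chart presenting `𝒪_{X',x'}`
  obtain ⟨j, 𝔴, χ, hχ, hloc, h𝔴⟩ := hπ.exists_reesChart_stalk x' g hgI
  letI algCO : Algebra (chartRing g j) (X'.presheaf.stalk x') := χ.toAlgebra
  letI algRO : Algebra (X.presheaf.stalk (π.base x')) (X'.presheaf.stalk x') := (π.stalkMap x').hom.toAlgebra
  haveI : IsLocalization.AtPrime (X'.presheaf.stalk x') 𝔴.asIdeal := hloc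
  have hp : (Ideal.span (Set.range g)).IsPermissible := by rw [hgI]; exact hIperm
  haveI : IsRegularLocalRing (X.presheaf.stalk (π.base x') ⧸ Ideal.span (Set.range g)) := hp.1
  haveI : IsDomain (X.presheaf.stalk (π.base x') ⧸ Ideal.span (Set.range g)) := isDomain_of_isRegularLocalRing _
  haveI : (Ideal.span (Set.range g)).IsPrime := (Ideal.Quotient.isDomain_iff_prime _).mp inferInstance
  have hs : ringKrullDim (X.presheaf.stalk (π.base x') ⧸ Ideal.span (Set.range g)) = s := by rw [hgI]; exact hdimI
  have hOO' : ∀ r : X.presheaf.stalk (π.base x'),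
      algebraMap (X.presheaf.stalk (π.base x')) (X'.presheaf.stalk x') r =
        (algebraMap (chartRing g j) (X'.presheaf.stalk x') : chartRing g j →+* X'.presheaf.stalk x') (chartBase g j r) :=
    fun r => (hχ r).symm
  -- `d = tr.deg(κ(x')/κ(x)) = dim 𝒪[𝔭/g_j]/𝔴`
  letI algk : Algebra (ResidueField (X.presheaf.stalk (π.base x'))) (ResidueField (X'.presheaf.stalk x')) :=
    residueAlgebraOfHom π x'
  have hres : ∀ r : X.presheaf.stalk (π.base x'),
      algebraMap (ResidueField (X.presheaf.stalk (π.base x'))) (ResidueField (X'.presheaf.stalk x'))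
        (residue _ r) = residue _ (algebraMap (X.presheaf.stalk (π.base x')) (X'.presheaf.stalk x') r) :=
    fun r => rfl
  obtain ⟨d', hd', htr'⟩ := exists_ringKrullDim_quotient_eq_and_trdeg_eq g j 𝔴.asIdeal (X'.presheaf.stalk x') h𝔴 hOO' hres
  have hdd : d' = d := by
    have h := htr'.symm.trans htr
    exact_mod_cast h
  subst hdd
  -- a chain of primes of length `d'` issuing from `𝔴`
  obtain ⟨t, ht, hlen⟩ := Order.exists_series_of_coheight_eq_coe
    (⟨𝔴.asIdeal, inferInstance⟩ : PrimeSpectrum (chartRing g j)) (coheight_eq_of_ringKrullDim_quotient_eq 𝔴.asIdeal hd')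
  have hH' : hilbertSamuelFun (X'.presheaf.stalk x') (t.length + 1) = hilbertSamuelFun (X.presheaf.stalk (π.base x')) 1 := by
    rw [hlen]; exact hH
  obtain ⟨hRd, h1⟩ := localRidgeDim_add_length_le_of_hilbertSamuelFun_eq g j 𝔴.asIdeal (X'.presheaf.stalk x') hs hp.2.1 h𝔴
    hOO' hI1 t (by rw [ht]) hH'
  rw [hlen, fibreConeIdeal_eq_normalConeIdeal] at hRd
  rw [fibreConeIdeal_eq_normalConeIdeal] at h1
  refine ⟨?_, ?_⟩
  · change localRidgeDim (X'.presheaf.stalk x') + d' ≤ Scheme.ridgeDim X (π.base x')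
    rw [hR]
    exact hRd
  · rw [hdimI, hR]
    exact_mod_cast (show s < ridgeDim (normalConeIdeal g) + s by omega)

/-- Summit-side alias of `Literature.AlgebraicGeometry.Resolution.Dietel2015_nearPoint_ridge_holds` in the campaign namespace.
OURS; NOT a statement of the manuscript. [cite: Dietel2015, Satz (8.2.7) (ii) p. 105] -/
theorem dietel2015_nearPoint_ridge_holds : Dietel2015_nearPoint_ridge.{u} :=
  Literature.AlgebraicGeometry.Resolution.Dietel2015_nearPoint_ridge_holds

end CampaignW42

/-- **Rescue-catalogue row RR-107 (`Rescue.RR_107 := Dietel2015_nearPoint_ridge ∧ Dietel2015_mainTheoremC`) is TRUE MODULO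
F-58 ALONE**: the F-54 conjunct is discharged (`Dietel2015_nearPoint_ridge_holds`). Improves `Rescue.RR_107_of_facts`
(`Rescue/RR107DirectrixRidge.lean`). OURS catalogue bookkeeping; NOT a statement of the manuscript; F-58
(`Dietel2015_mainTheoremC`, Main Theorem C via Oda's classification) stays a named hypothesis. [cite: Dietel2015, Satz (8.2.7) (ii) p. 105; Main Theorem C p. 130] -/
theorem Rescue.RR_107_of_mainTheoremC (h : Dietel2015_mainTheoremC.{u}) : Rescue.RR_107.{u} :=
  Rescue.RR_107_of_facts Literature.AlgebraicGeometry.Resolution.Dietel2015_nearPoint_ridge_holds h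

end Summit.ResolutionOfSingularities.ResolutionOfSingularities.Theorems

end
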